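import Literature.Topology.FourManifolds.ComplexProjectiveSpaceOrientationProofs
import Literature.NumberTheory.Transcendental.FormIntegrationPositivity

/-!
# Stub `helper_projectiveLineOrientation` of line `cross-cap-laurent` (crux `GromovRecognitionRelEnd`, item stmt-SmoothPoincare4-11009)

A piece of `helper_noJSpheres`: **the complex projective line `ℂℙ¹`
(`Literature.Topology.FourManifolds.ComplexProjectiveSpace 1`, charted on
`EuclideanSpace ℝ (Fin (2 * 1))`, model `𝓡 (2 * 1)`) is oriented by ANY constant orientation family
`x ↦ o₀`**, in the sense of the tree's integration theory
(`Literature.NumberTheory.Transcendental.IsContinuousOrientation`, `FormIntegration.lean`).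

Proof (the pattern of `Literature.NumberTheory.Transcendental.isContinuousOrientation_const` /
`chartSign_const_eq` for complex manifolds, `FormIntegrationPositivity.lean`): by
`chartSign_extChartAt`, the chart sign of the constant family at the chart point of `x` is
`sign (det (tangentCoordChange I p x x)) · sign (o₀(e))`; all chart changes of the affine atlas of
`ℂℙⁿ` have Jacobians of positive determinant
(`Literature.Topology.FourManifolds.ComplexProjectiveSpace.det_tangentCoordChange_pos`, which is
stated for the inverse change `tangentCoordChange I x p x`; the two determinants multiply to `1` by
the cocycle identity `tangentCoordChange_comp` / `tangentCoordChange_self`), so the chart signs are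
the non-zero constant `sign (o₀(e))` on every chart target, a neighbourhood of the centre within
`range I` (`extChartAt_target_mem_nhdsWithin`).
-/

noncomputable section

-- the prescribed namespace `Summit.<P>.<Sub>.…` duplicates `SmoothPoincare4` (P = Sub)
set_option linter.dupNamespace false

open scoped Manifold ContDiff Topology
open Set Module
open Literature.Topology.FourManifolds Literature.NumberTheory.Transcendental

namespace Summit.SmoothPoincare4.SmoothPoincare4.Theorems.GromovRecognitionRelEnd.CrossCapLaurent

/-- **The affine atlas of `ℂℙⁿ` is oriented, in the direction used by `chartSign_extChartAt`**: for
`x` in the source of the (extended) preferred chart at `p`, the Jacobian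
`tangentCoordChange (𝓡 (2 * n)) p x x` of the change from the chart at `p` to the chart at `x`, at `x`,
has positive determinant — its inverse `tangentCoordChange (𝓡 (2 * n)) x p x` has
(`ComplexProjectiveSpace.det_tangentCoordChange_pos`) and the two determinants multiply to `1`
(cocycle identity `tangentCoordChange_comp`, `tangentCoordChange_self`, `LinearMap.det_comp`).
[folklore] -/
theorem projectiveSpace_det_tangentCoordChange_pos {n : ℕ} {p x : ComplexProjectiveSpace n}
    (hx : x ∈ (extChartAt (𝓡 (2 * n)) p).source) :
    0 < LinearMap.det ((tangentCoordChange (𝓡 (2 * n)) p x x :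
        EuclideanSpace ℝ (Fin (2 * n)) →L[ℝ] EuclideanSpace ℝ (Fin (2 * n))) :
      EuclideanSpace ℝ (Fin (2 * n)) →ₗ[ℝ] EuclideanSpace ℝ (Fin (2 * n))) := by
  have hx' : x ∈ (chartAt (EuclideanSpace ℝ (Fin (2 * n))) p).source := by
    rwa [extChartAt_source] at hx
  -- the inverse change has positive determinant
  have hpos := ComplexProjectiveSpace.det_tangentCoordChange_pos hx'
  -- cocycle: (change `p → x` at `x`) ∘ (change `x → p` at `x`) = id
  have hcomp : (tangentCoordChange (𝓡 (2 * n)) p x x :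
        EuclideanSpace ℝ (Fin (2 * n)) →ₗ[ℝ] EuclideanSpace ℝ (Fin (2 * n))).comp
      (tangentCoordChange (𝓡 (2 * n)) x p x :
        EuclideanSpace ℝ (Fin (2 * n)) →ₗ[ℝ] EuclideanSpace ℝ (Fin (2 * n))) = LinearMap.id := by
    apply LinearMap.ext
    intro v
    simp only [ContinuousLinearMap.coe_coe, LinearMap.coe_comp, Function.comp_apply,
      LinearMap.id_coe, id_eq]
    rw [tangentCoordChange_comp ⟨⟨mem_extChartAt_source x, hx⟩, mem_extChartAt_source x⟩]
    exact tangentCoordChange_self (mem_extChartAt_source x)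
  have hdet : LinearMap.det (tangentCoordChange (𝓡 (2 * n)) p x x :
        EuclideanSpace ℝ (Fin (2 * n)) →ₗ[ℝ] EuclideanSpace ℝ (Fin (2 * n))) *
      LinearMap.det (tangentCoordChange (𝓡 (2 * n)) x p x :
        EuclideanSpace ℝ (Fin (2 * n)) →ₗ[ℝ] EuclideanSpace ℝ (Fin (2 * n))) = 1 := by
    rw [← LinearMap.det_comp, hcomp, LinearMap.det_id]
  exact (pos_iff_pos_of_mul_pos (hdet ▸ one_pos)).mpr hpos

/-- The sign of a representative `o₀.someVector` of an orientation of a real model space on the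
reference basis `modelBasis E m` is non-zero (a non-zero top-degree alternating form does not vanish
on a basis, `AlternatingMap.eq_smul_basis_det`); the real-model-space twin of
`Literature.NumberTheory.Transcendental.sign_someVector_modelBasis_ne_zero` (stated there for complex
model spaces). [folklore] -/
theorem sign_someVector_modelBasis_ne_zero_real {E : Type*} [NormedAddCommGroup E] [NormedSpace ℝ E]
    [FiniteDimensional ℝ E] {m : ℕ} [Fact (finrank ℝ E = m)] (o₀ : Orientation ℝ E (Fin m)) :
    Real.sign (o₀.someVector (modelBasis E m)) ≠ 0 := by
  intro h
  rw [Real.sign_eq_zero_iff] at h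
  have hψ : (o₀.someVector : E [⋀^Fin m]→ₗ[ℝ] ℝ) = 0 := by
    rw [AlternatingMap.eq_smul_basis_det (modelBasis E m) o₀.someVector, h, zero_smul]
  exact Module.Ray.someVector_ne_zero o₀ hψ

/-- **Chart signs of a constant orientation family on `ℂℙⁿ`**: on the whole target of every chart
they equal the constant `sign (o₀(e₁, …, e_m))`, the sign of (a representative of) `o₀` on the
reference frame — the coordinate changes of the affine atlas having positive determinant
(`projectiveSpace_det_tangentCoordChange_pos`, `chartSign_extChartAt`). [folklore] -/
theorem projectiveSpace_chartSign_const_eq {n m : ℕ}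
    [Fact (finrank ℝ (EuclideanSpace ℝ (Fin (2 * n))) = m)]
    (o₀ : Orientation ℝ (EuclideanSpace ℝ (Fin (2 * n))) (Fin m)) (p : ComplexProjectiveSpace n)
    {y : EuclideanSpace ℝ (Fin (2 * n))} (hy : y ∈ (extChartAt (𝓡 (2 * n)) p).target) :
    chartSign (I := 𝓡 (2 * n)) (M := ComplexProjectiveSpace n) (fun _ ↦ o₀) p y =
      Real.sign (o₀.someVector (modelBasis (EuclideanSpace ℝ (Fin (2 * n))) m)) := by
  have hx : (extChartAt (𝓡 (2 * n)) p).symm y ∈ (extChartAt (𝓡 (2 * n)) p).source :=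
    (extChartAt (𝓡 (2 * n)) p).map_target hy
  have hy' : y = extChartAt (𝓡 (2 * n)) p ((extChartAt (𝓡 (2 * n)) p).symm y) :=
    ((extChartAt (𝓡 (2 * n)) p).right_inv hy).symm
  rw [hy', chartSign_extChartAt _ hx,
    Real.sign_of_pos (projectiveSpace_det_tangentCoordChange_pos hx), one_mul]
  rfl

/-- **Stub `helper_projectiveLineOrientation` — `ℂℙ¹` is oriented by any constant orientation of the
model plane.** Every constant orientation family `x ↦ o₀` on the complex projective line
`ComplexProjectiveSpace 1` is a continuous orientation in the sense of
`Literature.NumberTheory.Transcendental.IsContinuousOrientation`: its chart signs are the non-zero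
constant `sign (o₀(e))` on the chart targets (`projectiveSpace_chartSign_const_eq`,
`sign_someVector_modelBasis_ne_zero_real`), which are neighbourhoods of the centres within `range I`
(`extChartAt_target_mem_nhdsWithin`). The complex-manifold pattern of
`Literature.NumberTheory.Transcendental.isContinuousOrientation_const` run on the affine atlas of
`ℂℙ¹` (`ComplexProjectiveSpace.det_tangentCoordChange_pos`: holomorphic chart changes have Jacobians
of positive real determinant). [folklore; cite: HuybrechtsCG2005, Cor. 1.2.3 (complex manifolds are canonically oriented)] -/
theorem helper_projectiveLineOrientation : ∀ [Fact (Module.finrank ℝ (EuclideanSpace ℝ (Fin (2 * 1))) = 2 * 1)] (o₀ : Orientation ℝ (EuclideanSpace ℝ (Fin (2 * 1))) (Fin (2 * 1))), Literature.NumberTheory.Transcendental.IsContinuousOrientation (I := 𝓡 (2 * 1)) (M := Literature.Topology.FourManifolds.ComplexProjectiveSpace 1) (fun _ => o₀) := by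
  intro _ o₀ x₀
  have hmem : (extChartAt (𝓡 (2 * 1)) x₀).target ∈
      𝓝[range (𝓡 (2 * 1))] (extChartAt (𝓡 (2 * 1)) x₀ x₀) :=
    extChartAt_target_mem_nhdsWithin x₀
  filter_upwards [hmem] with y hy
  rw [projectiveSpace_chartSign_const_eq o₀ x₀ hy,
    projectiveSpace_chartSign_const_eq o₀ x₀ (mem_extChartAt_target x₀)]
  exact ⟨rfl, sign_someVector_modelBasis_ne_zero_real o₀⟩

end Summit.SmoothPoincare4.SmoothPoincare4.Theorems.GromovRecognitionRelEnd.CrossCapLaurent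

end
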